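import Literature.Analysis.FluidPDE.SereginSverakOffAxisInputs
import Literature.Analysis.FluidPDE.SereginSverakIteration
import Literature.Analysis.FluidPDE.SuitableWeakCongr
import Literature.Analysis.FluidPDE.NSSuitableESSProofs
import HarnessLib

/-!
# Seregin–Šverák 2009, (as15): tools — the representative, the cylinders, the Hölder step

Proofs-only companion of `SereginSverakOffAxisInputs.lean` (which see for the sources, the printed
proof and the plan: G. Seregin, V. Šverák, arXiv:0804.1803, proof of Prop. 3.7, (as15);
G. Seregin, W. Zajaczkowski, arXiv:math/0702720, Lemma 2.3, (2.2), Prop. 4.1, Cor. 4.4). No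
definitions. Contents:

* `𝒜₂` (`szEnergy`) does not see null sets (`szEnergy_congr_ae`), and for a representative `V` in
  the class of Prop. 4.1, `𝒜₂(V, p; D_x V) = 𝒜₂(u, p; G)` for any weak spatial gradient `G` of `u`
  (`szEnergy_representative_eq`: accepted `HasWeakSpatialGradientOn.congr_ae`, `.ae_eq`,
  `hasWeakSpatialGradientOn_fderiv`); hence, from the accepted named facts of
  `SereginZajaczkowski2007.lean` and `OffAxisSmoothRepresentative`: Cor. 4.4 for the pairs under
  the conditions of Thm. 3.1 (`sixthPower_le_of_offAxisL6Bound`) and the reduction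
  `unitScaleOffAxisBound_of_offAxisSupBound : OffAxisSupBound → OffAxisSmoothRepresentative →
  UnitScaleOffAxisBound` left open there;
* the geometry of the cylinders `Q(z₀, r)`, `r ≤ 1/4`, hanging from the centres
  `z₀ ∈ 𝒞(1,2;1) × ]-1,0[` ("`Q(z₀, 1/4) ⊂ Q̂`", SZ2007 p. 3): they lie in `Q̃₂`, in `Q̃ = Q²₁(0)`
  and in `Q(0, 3)`; the ball cylinders `Q_r(z₀)` lie in `Q(z₀, r)`;
* the Hölder step of the proof of Lemma 2.3 in ball form: `|Q_r(z₀)| = r⁵ |B₁|` and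
  `C(s²; z₀) ≤ (|B₁| m)^{1/2} s` from `∫_{Q̃₂} |u|⁶ ≤ m` (`cknC_le_of_sixth_bound`);
* the class `IsTypeIAxisymmetricSolutionOn` under the scaling between two radii (`rescaleFrom`,
  the general form of the accepted `rescale`) and, from Remark 3.4 on `Q = Q(0,1)`
  (`SuitableOfBounded`) and the accepted covariance `IsSuitableWeakSolutionOn.stRescale`, the
  suitability of every pair of the class on `Q(0, 3)` (`IsTypeIAxisymmetricSolutionOn.isSuitable`);
* the four bounds packed in `𝒜₂ ≤ K` (`szEnergy_bounds`), `D(1/4; z₀) ≤ 16K`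
  (`cknD_quarter_le_of_bound`), one step of the iteration in `ℝ≥0∞` (`decay_step_ennreal`), the
  ratios of consecutive scales, a ratio `σ` with `cσ² ≤ 1/2`, and the elementary facts on the
  scales `s_k`.

## References

* G. Seregin, V. Šverák, Comm. PDE 34 (2009), arXiv:0804.1803: §3 (scaling, p. 9; Remark 3.4),
  proof of Prop. 3.7 (p. 10). [`SereginSverak2009`]
* G. Seregin, W. Zajaczkowski, SIAM J. Math. Anal. 39 (2007), arXiv:math/0702720: proof of
  Lemma 2.3 (p. 3), Prop. 4.1, Cor. 4.4 (pp. 5–7). [`SereginZajaczkowski2007`]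
-/

noncomputable section

open MeasureTheory Set Function Filter Topology TopologicalSpace Module Metric
open scoped NNReal ENNReal

namespace Literature.Analysis.FluidPDE

namespace SereginSverak2009

open SereginZajaczkowski2007

/-! ### `𝒜₂` and the `L₆` bound do not see null sets: Cor. 4.4 and Prop. 4.1 for the class -/

section Representative

variable {u V : ℝ → (EuclideanSpace ℝ (Fin 3)) → (EuclideanSpace ℝ (Fin 3))} {p : ℝ → (EuclideanSpace ℝ (Fin 3)) → ℝ} {G G' : ℝ → (EuclideanSpace ℝ (Fin 3)) → (EuclideanSpace ℝ (Fin 3)) →L[ℝ] (EuclideanSpace ℝ (Fin 3))}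

/-- `Q̃ = ]-2², 0[ × 𝒫²₁(0)` as a product set. [folklore] -/
theorem outerShell_one_eq_prod : outerShell 1 0 = Ioo (-2 ^ 2 : ℝ) 0 ×ˢ outerShellSpace 1 0 := by
  ext z
  rw [mem_outerShell, mem_prod]
  norm_num

/-- **`𝒜₂` is invariant under a.e. modification** of the field and of the gradient on `Q̃`: its
four terms only see `u`, `G`, `p` through integrals over `Q̃` and, for the first one, through the
spatial integrals over `𝒫²₁(0)` at a.e. time (Tonelli). [folklore] -/
theorem szEnergy_congr_ae (huV : ∀ᵐ z ∂(volume.restrict (outerShell 1 0)), uncurry u z = uncurry V z)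
    (hGG' : ∀ᵐ z ∂(volume.restrict (outerShell 1 0)), uncurry G z = uncurry G' z) :
    szEnergy u p G = szEnergy V p G' := by
  have eA : essSup (fun s : ℝ => ∫⁻ y in outerShellSpace 1 0, ‖u s y‖ₑ ^ 2)
        (volume.restrict (Ioo (-2 ^ 2) 0)) =
      essSup (fun s : ℝ => ∫⁻ y in outerShellSpace 1 0, ‖V s y‖ₑ ^ 2)
        (volume.restrict (Ioo (-2 ^ 2) 0)) := by
    have hprod : (volume.restrict (outerShell 1 0) : Measure (ℝ × (EuclideanSpace ℝ (Fin 3)))) =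
        (volume.restrict (Ioo (-2 ^ 2 : ℝ) 0)).prod (volume.restrict (outerShellSpace 1 0)) := by
      rw [outerShell_one_eq_prod, Measure.volume_eq_prod, Measure.prod_restrict]
    have h1 : ∀ᵐ z ∂((volume.restrict (Ioo (-2 ^ 2 : ℝ) 0)).prod
        (volume.restrict (outerShellSpace 1 0))), uncurry u z = uncurry V z := by
      rw [← hprod]
      exact huV
    have h2 := Measure.ae_ae_of_ae_prod h1
    refine essSup_congr_ae ?_
    filter_upwards [h2] with s hs
    refine lintegral_congr_ae ?_
    filter_upwards [hs] with y hy
    simp only [uncurry] at hy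
    rw [hy]
  have eE : ∫⁻ z in outerShell 1 0, ENNReal.ofReal (frobeniusNormSq (G z.1 z.2)) =
      ∫⁻ z in outerShell 1 0, ENNReal.ofReal (frobeniusNormSq (G' z.1 z.2)) := by
    refine lintegral_congr_ae ?_
    filter_upwards [hGG'] with z hz
    simp only [uncurry] at hz
    rw [hz]
  have eC : ∫⁻ z in outerShell 1 0, ‖u z.1 z.2‖ₑ ^ (3 : ℕ) =
      ∫⁻ z in outerShell 1 0, ‖V z.1 z.2‖ₑ ^ (3 : ℕ) := by
    refine lintegral_congr_ae ?_
    filter_upwards [huV] with z hz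
    simp only [uncurry] at hz
    rw [hz]
  unfold szEnergy
  rw [eA, eE, eC]

/-- For a representative `V` of `u` on `Q̃` in the class of Prop. 4.1, `𝒜₂` computed with `V` and
its classical gradient is `𝒜₂` computed with `u` and any weak spatial gradient `G` of `u` on
`Q(0, 3)` (weak gradients pass to a.e.-equal fields and are a.e. unique; accepted
`HasWeakSpatialGradientOn.congr_ae`, `HasWeakSpatialGradientOn.ae_eq`,
`hasWeakSpatialGradientOn_fderiv`). [folklore] -/
theorem szEnergy_representative_eq
    (hV : IsSmoothAxisymmetricSolutionOn (shellCylOpens (1 / 4) 3 2 2) V p)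
    (huV : ∀ᵐ z ∂(volume.restrict (shellCyl (1 / 4) 3 2 2)), uncurry u z = uncurry V z)
    (hG : HasWeakSpatialGradientOn (parCylOpens 0 3) u G) :
    szEnergy V p (fun t x => fderiv ℝ (V t) x) = szEnergy u p G := by
  have hle : shellCylOpens (1 / 4) 3 2 2 ≤ parCylOpens (0 : ℝ × (EuclideanSpace ℝ (Fin 3))) 3 := by
    intro z hz
    have hz' : z ∈ outerShell 1 0 := by rw [outerShell_one_eq]; exact hz
    exact outerShell_one_subset hz'
  have hG1 : HasWeakSpatialGradientOn (shellCylOpens (1 / 4) 3 2 2) V G :=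
    (hG.mono hle).congr_ae huV
  have hG2 : HasWeakSpatialGradientOn (shellCylOpens (1 / 4) 3 2 2) V fun t x => fderiv ℝ (V t) x :=
    hasWeakSpatialGradientOn_fderiv hV.continuousOn_velocity hV.continuousOn_fderiv
      fun z hz => hV.differentiableAt hz
  have hGG := hG1.ae_eq hG2
  rw [coe_shellCylOpens, ← outerShell_one_eq] at hGG
  rw [← outerShell_one_eq] at huV
  exact (szEnergy_congr_ae huV hGG).symm

/-- **Seregin–Zajaczkowski 2007, Cor. 4.4, for the pairs under the conditions of Thm. 3.1**
(Seregin–Šverák 2009, (as15) is Prop. 4.1 for these pairs, whose printed proof goes through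
Cor. 4.4): from the accepted named fact `SereginZajaczkowski2007.OffAxisL6Bound` (Cor. 4.4 for the
smooth class) and `OffAxisSmoothRepresentative`, every pair of the class
`IsTypeIAxisymmetricSolutionOn 3` with `𝒜₂(u, p) ≤ K` (`szEnergy`, any weak spatial gradient `G` on
`Q(0,3)`) satisfies `∫_{Q̃₂} |u|⁶ ≤ Φ₆ K`, `Q̃₂ = 𝒞(3/8, 5/2; 3/2) × ]-(3/2)², 0[`, with the `Φ₆` of
Cor. 4.4. [cite: SereginZajaczkowski2007, Cor. 4.4 ((4.19), arXiv p. 7)] -/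
theorem sixthPower_le_of_offAxisL6Bound (h44 : OffAxisL6Bound) (hreg : OffAxisSmoothRepresentative) :
    ∃ Φ₆ : ℝ≥0 → ℝ≥0, Monotone Φ₆ ∧
      ∀ (u : ℝ → (EuclideanSpace ℝ (Fin 3)) → (EuclideanSpace ℝ (Fin 3))) (p : ℝ → (EuclideanSpace ℝ (Fin 3)) → ℝ), IsTypeIAxisymmetricSolutionOn 3 u p →
        ∀ G : ℝ → (EuclideanSpace ℝ (Fin 3)) → (EuclideanSpace ℝ (Fin 3)) →L[ℝ] (EuclideanSpace ℝ (Fin 3)), HasWeakSpatialGradientOn (parCylOpens 0 3) u G →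
          ∀ K : ℝ≥0, szEnergy u p G ≤ K →
            ∫⁻ z in shellCyl (3 / 8) (5 / 2) (3 / 2) (3 / 2), ‖u z.1 z.2‖ₑ ^ (6 : ℕ) ≤ Φ₆ K := by
  obtain ⟨Φ₆, hΦ₆, h44⟩ := h44
  refine ⟨Φ₆, hΦ₆, fun u p h3 G hG K hK => ?_⟩
  obtain ⟨V, hV, huV⟩ := hreg u p h3
  have hKV : szEnergy V p (fun t x => fderiv ℝ (V t) x) ≤ K := by
    rw [szEnergy_representative_eq hV huV hG]
    exact hK
  have h6 := h44 V p hV K hKV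
  have huV2 : ∀ᵐ z ∂(volume.restrict (shellCyl (3 / 8) (5 / 2) (3 / 2) (3 / 2))),
      uncurry u z = uncurry V z := ae_restrict_of_ae_restrict_of_subset shellCyl_two_subset_tilde huV
  calc ∫⁻ z in shellCyl (3 / 8) (5 / 2) (3 / 2) (3 / 2), ‖u z.1 z.2‖ₑ ^ (6 : ℕ)
      = ∫⁻ z in shellCyl (3 / 8) (5 / 2) (3 / 2) (3 / 2), ‖V z.1 z.2‖ₑ ^ (6 : ℕ) := by
        refine lintegral_congr_ae ?_
        filter_upwards [huV2] with z hz
        simp only [uncurry] at hz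
        rw [hz]
    _ ≤ Φ₆ K := h6

/-- **Seregin–Šverák 2009, (as15), from Seregin–Zajaczkowski 2007, Prop. 4.1** ("As it was shown in
[S11], there exists a continuous nondecreasing function `Φ` such that (as15)", arXiv p. 10): the
accepted named fact `SereginZajaczkowski2007.OffAxisSupBound` (Prop. 4.1 for the smooth class,
pointwise on `𝒞(1,2;1) × ]-1,0[`) and `OffAxisSmoothRepresentative` give `UnitScaleOffAxisBound`
(the same `Φ`; the bound passes from the representative `V` to the a.e.-equal `u`, the gradient
half is dropped). [cite: SereginSverak2009, proof of Prop. 3.7, (as15) (arXiv p. 10)] -/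
theorem unitScaleOffAxisBound_of_offAxisSupBound (h41 : OffAxisSupBound)
    (hreg : OffAxisSmoothRepresentative) : UnitScaleOffAxisBound := by
  obtain ⟨Φ, hΦ, h41⟩ := h41
  refine ⟨Φ, hΦ, fun u p h3 G hG K hK => ?_⟩
  obtain ⟨V, hV, huV⟩ := hreg u p h3
  have hKV : szEnergy V p (fun t x => fderiv ℝ (V t) x) ≤ K := by
    rw [szEnergy_representative_eq hV huV hG]
    exact hK
  have hpt := h41 V p hV K hKV
  have huV1 : ∀ᵐ z ∂(volume.restrict (innerShell 1 0)), uncurry u z = uncurry V z := by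
    rw [innerShell_one_eq]
    exact ae_restrict_of_ae_restrict_of_subset
      (shellCyl_one_subset_hat.trans shellCyl_hat_subset_tilde) huV
  have hmem : ∀ᵐ z ∂(volume.restrict (innerShell 1 0)), z ∈ innerShell 1 0 :=
    ae_restrict_mem (measurableSet_innerShell 1 0)
  filter_upwards [huV1, hmem] with z hz hzS
  simp only [uncurry] at hz
  rw [hz]
  rw [innerShell_one_eq] at hzS
  exact le_trans (le_add_of_nonneg_right (Real.sqrt_nonneg _)) (hpt z hzS)

end Representative

/-! ### Geometry of the cylinders hanging from the centres `z₀ ∈ 𝒞(1,2;1) × ]-1,0[` -/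

section Geometry

/-- Balls lie in the cylinders of the same radius: `B(x₀, r) ⊆ 𝒞(x₀, r)` (`|y'| ≤ ‖y‖`,
`|y₃| ≤ ‖y‖`). [folklore] -/
theorem ball_subset_spaceCyl (x₀ : (EuclideanSpace ℝ (Fin 3))) (r : ℝ) : ball x₀ r ⊆ spaceCyl x₀ r := by
  intro x hx
  rw [mem_ball, dist_eq_norm] at hx
  rw [mem_spaceCyl]
  refine ⟨(cylRadius_le_norm' _).trans_lt hx, ?_⟩
  have h := norm_sq_eq_cylRadius_sq_add (x - x₀)
  have h1 : |(x - x₀) 2| ^ 2 ≤ ‖x - x₀‖ ^ 2 := by rw [sq_abs]; nlinarith [sq_nonneg (cylRadius (x - x₀))]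
  have h2 : |(x - x₀) 2| ≤ ‖x - x₀‖ :=
    (pow_le_pow_iff_left₀ (abs_nonneg _) (norm_nonneg _) two_ne_zero).1 h1
  rw [PiLp.sub_apply] at h2
  exact h2.trans_lt hx

/-- `Q_r(z₀) ⊆ Q(z₀, r)`: the parabolic cylinders over balls (Caffarelli–Kohn–Nirenberg, Lin,
Seregin 2001) lie in those over the cylinders `𝒞(x₀, r)` (Seregin–Šverák, Seregin–Zajaczkowski).
[folklore] -/
theorem parabolicCylinder_subset_parCyl (r : ℝ) (z₀ : ℝ × (EuclideanSpace ℝ (Fin 3))) :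
    parabolicCylinder r z₀ ⊆ parCyl z₀ r := by
  intro z hz
  rw [mem_parabolicCylinder] at hz
  exact ⟨hz.1, ball_subset_spaceCyl z₀.2 r hz.2⟩

variable {z₀ : ℝ × (EuclideanSpace ℝ (Fin 3))} {r : ℝ}

/-- For `z₀ ∈ 𝒞(1,2;1) × ]-1,0[` and `r ≤ 1/4`, the points of `Q(z₀, r)` satisfy
`-17/16 < t < 0`, `3/4 < |x'| < 9/4`, `|x₃| < 5/4` ("`Q(z₀, 1/4) ⊂ Q̂`", Seregin–Zajaczkowski 2007,
proof of Lemma 2.3). [cite: SereginZajaczkowski2007, proof of Lemma 2.3 (arXiv p. 3)] -/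
theorem mem_bounds_of_mem_parCyl (h₀ : z₀ ∈ shellCyl 1 2 1 1) (hr : r ≤ 1 / 4) {z : ℝ × (EuclideanSpace ℝ (Fin 3))}
    (hz : z ∈ parCyl z₀ r) :
    (-(17 : ℝ) / 16 < z.1 ∧ z.1 < 0) ∧ ((3 : ℝ) / 4 < cylRadius z.2 ∧ cylRadius z.2 < 9 / 4) ∧
      |z.2 2| < 5 / 4 := by
  obtain ⟨⟨ht1, ht2⟩, ⟨hc1, hc2⟩, hx3⟩ := mem_shellCyl.1 h₀
  norm_num at ht1
  rw [mem_parCyl] at hz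
  obtain ⟨⟨h1, h2⟩, h3, h4⟩ := hz
  have hr0 : 0 < r := (cylRadius_nonneg _).trans_lt h3
  have hr2 : r ^ 2 ≤ 1 / 16 := by nlinarith
  refine ⟨⟨by linarith, by linarith⟩, ⟨?_, ?_⟩, ?_⟩
  · have := cylRadius_le_cylRadius_add z₀.2 z.2
    rw [cylRadius_sub_comm] at this
    linarith
  · have := cylRadius_le_cylRadius_add z.2 z₀.2
    linarith
  · have h5 : |z.2 2| ≤ |z.2 2 - z₀.2 2| + |z₀.2 2| := by
      calc |z.2 2| = |z.2 2 - z₀.2 2 + z₀.2 2| := by rw [sub_add_cancel]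
        _ ≤ |z.2 2 - z₀.2 2| + |z₀.2 2| := abs_add_le _ _
    linarith

/-- `Q(z₀, r) ⊆ Q̃₂ = 𝒞(3/8, 5/2; 3/2) × ]-(3/2)², 0[` for such centres and `r ≤ 1/4`.
[cite: SereginZajaczkowski2007, proof of Lemma 2.3 (arXiv p. 3)] -/
theorem parCyl_subset_shellCyl_two (h₀ : z₀ ∈ shellCyl 1 2 1 1) (hr : r ≤ 1 / 4) :
    parCyl z₀ r ⊆ shellCyl (3 / 8) (5 / 2) (3 / 2) (3 / 2) := by
  intro z hz
  obtain ⟨⟨h1, h2⟩, ⟨h3, h4⟩, h5⟩ := mem_bounds_of_mem_parCyl h₀ hr hz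
  rw [mem_shellCyl]
  exact ⟨⟨by nlinarith, h2⟩, ⟨by linarith, by linarith⟩, by linarith⟩

/-- `Q(z₀, r) ⊆ Q̃ = Q²₁(0)` for such centres and `r ≤ 1/4`.
[cite: SereginZajaczkowski2007, proof of Lemma 2.3 (arXiv p. 3)] -/
theorem parCyl_subset_outerShell (h₀ : z₀ ∈ shellCyl 1 2 1 1) (hr : r ≤ 1 / 4) :
    parCyl z₀ r ⊆ outerShell 1 0 := by
  intro z hz
  obtain ⟨⟨h1, h2⟩, ⟨h3, h4⟩, h5⟩ := mem_bounds_of_mem_parCyl h₀ hr hz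
  rw [mem_outerShell, mem_outerShellSpace, sub_zero]
  exact ⟨⟨by linarith, h2⟩, ⟨by linarith, by linarith⟩, by linarith⟩

/-- `𝒞(x₀, r) ⊆ 𝒫²₁(0)` for such centres and `0 < r ≤ 1/4`. [folklore] -/
theorem spaceCyl_subset_outerShellSpace (h₀ : z₀ ∈ shellCyl 1 2 1 1) (hr0 : 0 < r)
    (hr : r ≤ 1 / 4) : spaceCyl z₀.2 r ⊆ outerShellSpace 1 0 := by
  intro x hx
  have ht : z₀.1 - r ^ 2 / 2 ∈ Ioo (z₀.1 - r ^ 2) z₀.1 := ⟨by nlinarith, by nlinarith⟩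
  have hz : ((z₀.1 - r ^ 2 / 2, x) : ℝ × (EuclideanSpace ℝ (Fin 3))) ∈ parCyl z₀ r := ⟨ht, hx⟩
  exact (mem_outerShell.1 (parCyl_subset_outerShell h₀ hr hz)).2

/-- `Q(z₀, r) ⊆ Q(0, 3)` for such centres and `r ≤ 1/4`. [folklore] -/
theorem parCyl_subset_parCyl_three (h₀ : z₀ ∈ shellCyl 1 2 1 1) (hr : r ≤ 1 / 4) :
    parCyl z₀ r ⊆ parCyl (0 : ℝ × (EuclideanSpace ℝ (Fin 3))) 3 :=
  (parCyl_subset_outerShell h₀ hr).trans outerShell_one_subset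

end Geometry

/-! ### The Hölder step `C(z₀, r) ≤ (|B₁| m)^{1/2} r^{1/2}` of the proof of Lemma 2.3 -/

section Holder

/-- `|Q_r(z₀)| = r² · r³ |B₁|`. [folklore] -/
theorem volume_parabolicCylinder_eq (z₀ : ℝ × (EuclideanSpace ℝ (Fin 3))) {r : ℝ} (hr : 0 ≤ r) :
    volume (parabolicCylinder r z₀) = ENNReal.ofReal (r ^ 5) * volume (ball (0 : (EuclideanSpace ℝ (Fin 3))) 1) := by
  rw [parabolicCylinder, Measure.volume_eq_prod, Measure.prod_prod, Real.volume_Ioo,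
    Measure.addHaar_ball volume z₀.2 hr, finrank_euclideanSpace_fin, ← mul_assoc,
    ← ENNReal.ofReal_mul (by nlinarith)]
  congr 2
  ring

/-- Cauchy–Schwarz: `∫_S |u|³ ≤ (∫_S |u|⁶)^{1/2} |S|^{1/2}`. [folklore] -/
theorem setLIntegral_cube_le {S : Set (ℝ × (EuclideanSpace ℝ (Fin 3)))} {u : ℝ → (EuclideanSpace ℝ (Fin 3)) → (EuclideanSpace ℝ (Fin 3))}
    (hu : AEMeasurable (fun z : ℝ × (EuclideanSpace ℝ (Fin 3)) => ‖u z.1 z.2‖ₑ) (volume.restrict S)) :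
    ∫⁻ z in S, ‖u z.1 z.2‖ₑ ^ (3 : ℕ) ≤
      (∫⁻ z in S, ‖u z.1 z.2‖ₑ ^ (6 : ℕ)) ^ (2⁻¹ : ℝ) * volume S ^ (2⁻¹ : ℝ) := by
  have h := ENNReal.lintegral_mul_le_Lp_mul_Lq (volume.restrict S) Real.HolderConjugate.two_two
    (f := fun z : ℝ × (EuclideanSpace ℝ (Fin 3)) => ‖u z.1 z.2‖ₑ ^ (3 : ℕ)) (g := fun _ => 1) (hu.pow_const _)
    aemeasurable_const
  simp only [Pi.mul_apply, mul_one, ENNReal.one_rpow, lintegral_one, Measure.restrict_apply_univ,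
    one_div] at h
  have e : ∀ z : ℝ × (EuclideanSpace ℝ (Fin 3)), (‖u z.1 z.2‖ₑ ^ (3 : ℕ)) ^ (2 : ℝ) = ‖u z.1 z.2‖ₑ ^ (6 : ℕ) := by
    intro z
    rw [ENNReal.rpow_two, ← pow_mul]
  simp_rw [e] at h
  exact h

/-- `(ofReal (s ^ 10)) ^ (1/2) = ofReal (s ^ 5)` for `s ≥ 0`. [folklore] -/
theorem ofReal_pow_ten_rpow_half {s : ℝ} (hs : 0 ≤ s) :
    ENNReal.ofReal (s ^ 10) ^ (2⁻¹ : ℝ) = ENNReal.ofReal (s ^ 5) := by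
  rw [show s ^ 10 = (s ^ 5) ^ 2 by ring, ENNReal.ofReal_pow (by positivity),
    ← ENNReal.rpow_natCast, ← ENNReal.rpow_mul]
  norm_num

variable {z₀ : ℝ × (EuclideanSpace ℝ (Fin 3))}

/-- **The Hölder step of the proof of Lemma 2.3** (Seregin–Zajaczkowski 2007, arXiv p. 3: "It
follows from (2.2), Hölder's inequality, and (2.6) that … `(r₁/r)² m^{1/2} r₁^{1/2}`"): an `L₆`
bound `∫_{Q̃₂} |u|⁶ ≤ m` gives `C(s²; z₀) ≤ (|B₁| m)^{1/2} s` (`C = cknC` over `Q_{s²}(z₀)`) for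
centres `z₀ ∈ 𝒞(1,2;1) × ]-1,0[` and `s² ≤ 1/4` (`s = r^{1/2}`).
[cite: SereginZajaczkowski2007, proof of Lemma 2.3 (arXiv p. 3)] -/
theorem cknC_le_of_sixth_bound {u : ℝ → (EuclideanSpace ℝ (Fin 3)) → (EuclideanSpace ℝ (Fin 3))} {m : ℝ≥0∞}
    (hu : AEStronglyMeasurable (uncurry u) (volume.restrict (parCyl (0 : ℝ × (EuclideanSpace ℝ (Fin 3))) 3)))
    (h6 : ∫⁻ z in shellCyl (3 / 8) (5 / 2) (3 / 2) (3 / 2), ‖u z.1 z.2‖ₑ ^ (6 : ℕ) ≤ m)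
    (h₀ : z₀ ∈ shellCyl 1 2 1 1) {s : ℝ} (hs : 0 < s) (hs4 : s ^ 2 ≤ 1 / 4) :
    cknC (s ^ 2) z₀ u ≤ (volume (ball (0 : (EuclideanSpace ℝ (Fin 3))) 1) * m) ^ (2⁻¹ : ℝ) * ENNReal.ofReal s := by
  set S := parabolicCylinder (s ^ 2) z₀ with hS
  have hS3 : S ⊆ parCyl (0 : ℝ × (EuclideanSpace ℝ (Fin 3))) 3 :=
    (parabolicCylinder_subset_parCyl _ _).trans (parCyl_subset_parCyl_three h₀ hs4)
  have hS6 : S ⊆ shellCyl (3 / 8) (5 / 2) (3 / 2) (3 / 2) :=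
    (parabolicCylinder_subset_parCyl _ _).trans (parCyl_subset_shellCyl_two h₀ hs4)
  have hmeas : AEMeasurable (fun z : ℝ × (EuclideanSpace ℝ (Fin 3)) => ‖u z.1 z.2‖ₑ) (volume.restrict S) :=
    (hu.mono_measure (Measure.restrict_mono hS3 le_rfl)).enorm
  have h1 := setLIntegral_cube_le hmeas
  have h2 : (∫⁻ z in S, ‖u z.1 z.2‖ₑ ^ (6 : ℕ)) ^ (2⁻¹ : ℝ) ≤ m ^ (2⁻¹ : ℝ) :=
    ENNReal.rpow_le_rpow ((lintegral_mono_set hS6).trans h6) (by norm_num)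
  have h3 : volume S ^ (2⁻¹ : ℝ) = volume (ball (0 : (EuclideanSpace ℝ (Fin 3))) 1) ^ (2⁻¹ : ℝ) * ENNReal.ofReal (s ^ 5) := by
    rw [hS, volume_parabolicCylinder_eq z₀ (by positivity), show (s ^ 2) ^ 5 = s ^ 10 by ring,
      ENNReal.mul_rpow_of_nonneg _ _ (by norm_num), ofReal_pow_ten_rpow_half hs.le, mul_comm]
  unfold cknC
  rw [← hS]
  calc (ENNReal.ofReal (s ^ 2) ^ 2)⁻¹ * ∫⁻ z in S, ‖u z.1 z.2‖ₑ ^ (3 : ℕ)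
      ≤ (ENNReal.ofReal (s ^ 2) ^ 2)⁻¹ * (m ^ (2⁻¹ : ℝ) *
          (volume (ball (0 : (EuclideanSpace ℝ (Fin 3))) 1) ^ (2⁻¹ : ℝ) * ENNReal.ofReal (s ^ 5))) := by
        gcongr
        exact h1.trans (by rw [h3]; exact mul_le_mul' h2 le_rfl)
    _ = (volume (ball (0 : (EuclideanSpace ℝ (Fin 3))) 1) * m) ^ (2⁻¹ : ℝ) * ENNReal.ofReal s := by
        rw [ofReal_pow_inv (by positivity : 0 < s ^ 2) 2, ENNReal.mul_rpow_of_nonneg _ m (by norm_num)]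
        have e4 : ENNReal.ofReal (((s ^ 2) ^ 2)⁻¹) * ENNReal.ofReal (s ^ 5) = ENNReal.ofReal s := by
          rw [← ENNReal.ofReal_mul (by positivity)]
          congr 1
          field_simp
        calc ENNReal.ofReal (((s ^ 2) ^ 2)⁻¹) * (m ^ (2⁻¹ : ℝ) *
              (volume (ball (0 : (EuclideanSpace ℝ (Fin 3))) 1) ^ (2⁻¹ : ℝ) * ENNReal.ofReal (s ^ 5)))
            = volume (ball (0 : (EuclideanSpace ℝ (Fin 3))) 1) ^ (2⁻¹ : ℝ) * m ^ (2⁻¹ : ℝ) *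
                (ENNReal.ofReal (((s ^ 2) ^ 2)⁻¹) * ENNReal.ofReal (s ^ 5)) := by ring
          _ = volume (ball (0 : (EuclideanSpace ℝ (Fin 3))) 1) ^ (2⁻¹ : ℝ) * m ^ (2⁻¹ : ℝ) * ENNReal.ofReal s := by rw [e4]

end Holder

/-! ### The class seen from scale `3`: suitability on `Q(0, 3)` -/

/-- **The conditions of Theorem 3.1 under the scaling, general radii**: if `(v, q)` satisfies them
on `Q(0, R₀)` and `Q(z_b, λR) ⊆ Q(0, R₀)` (`0 < λ`, `λR ≤ R₀`, `|b| + λR ≤ R₀`), then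
`u(s, y) = λ v(λ² s, b e₃ + λ y)`, `p = λ² q ∘ Φ` satisfy them on `Q(0, R) = Φ⁻¹(Q(z_b, λR))`
(same proof as the accepted `IsTypeIAxisymmetricSolutionOn.rescale`, which is the case `R₀ = 1`;
Seregin–Šverák 2009, §3, p. 9: invariance of the Navier–Stokes equations under
`u(x,t) = λv(λx, λ²t)`, `p = λ²q`).
[cite: SereginSverak2009, §3 (scaling, arXiv p. 9) and proof of Prop. 3.7 (arXiv p. 10)] -/
theorem IsTypeIAxisymmetricSolutionOn.rescaleFrom {R₀ : ℝ} {v : ℝ → (EuclideanSpace ℝ (Fin 3)) → (EuclideanSpace ℝ (Fin 3))} {q : ℝ → (EuclideanSpace ℝ (Fin 3)) → ℝ}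
    (h : IsTypeIAxisymmetricSolutionOn R₀ v q) {lam R : ℝ} (hlam : 0 < lam) (hR : 0 < R)
    (hR1 : lam * R ≤ R₀) (b : ℝ) (hb : |b| + lam * R ≤ R₀) :
    IsTypeIAxisymmetricSolutionOn R (lam • stPull (lam ^ 2) lam 0 (b • eZ) v)
      (lam ^ 2 • stPull (lam ^ 2) lam 0 (b • eZ) q) := by
  have hl2 : 0 < lam ^ 2 := by positivity
  have hlR : 0 ≤ lam * R := by positivity
  have hpre : stAffine (lam ^ 2) lam 0 (b • eZ) ⁻¹' parCyl ((0 : ℝ), b • eZ) (lam * R) =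
      parCyl 0 R := preimage_parCyl_axisAffine hlam b R
  have hsubQ : parCyl ((0 : ℝ), b • eZ) (lam * R) ⊆ parCyl 0 R₀ := parCyl_axis_subset hlR hb
  have hsub : parCyl (0 : ℝ × (EuclideanSpace ℝ (Fin 3))) R ⊆ stAffine (lam ^ 2) lam 0 (b • eZ) ⁻¹' parCyl 0 R₀ := by
    rw [← hpre]
    exact preimage_mono hsubQ
  have hle : parCylOpens (0 : ℝ × (EuclideanSpace ℝ (Fin 3))) R ≤
      stPreimage (lam ^ 2) lam 0 (b • eZ) (parCylOpens 0 R₀) := fun z hz => hsub hz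
  have hfin : ENNReal.ofReal (lam ^ 2 * lam ^ finrank ℝ (EuclideanSpace ℝ (Fin 3)))⁻¹ ≠ ∞ := ENNReal.ofReal_ne_top
  refine ⟨?_, ?_, ?_, ?_, ?_⟩
  · have key := h.distributional.stRescale hlam hlam (sq lam) 0 (b • eZ)
    have hν : lam * 1 / lam = 1 := by field_simp
    have hf : ((lam ^ 2 * lam) • stPull (lam ^ 2) lam 0 (b • eZ) (0 : ℝ → (EuclideanSpace ℝ (Fin 3)) → (EuclideanSpace ℝ (Fin 3)))) = 0 := by
      funext s y
      simp [stPull]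
    rw [hν, hf] at key
    exact key.of_le hle
  · rw [← hpre, setLIntegral_enorm_pow_stRescale hl2 hlam 0 (b • eZ) lam v _ 3]
    refine ENNReal.mul_lt_top (ENNReal.mul_lt_top ?_ hfin.lt_top) ?_
    · exact (ENNReal.pow_lt_top enorm_lt_top)
    · exact (lintegral_mono_set hsubQ).trans_lt h.velocity_L3
  · rw [← hpre, setLIntegral_enorm_rpow_stRescale hl2 hlam 0 (b • eZ) (lam ^ 2) q _
      (by norm_num : (0 : ℝ) ≤ 3 / 2)]
    refine ENNReal.mul_lt_top (ENNReal.mul_lt_top ?_ hfin.lt_top) ?_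
    · exact ENNReal.rpow_lt_top_of_nonneg (by norm_num) enorm_ne_top
    · exact (lintegral_mono_set hsubQ).trans_lt h.pressure_L32
  · intro s hs
    have ht : 0 + lam ^ 2 * s ∈ Ioo (-R₀ ^ 2 : ℝ) 0 := by
      have h1 : (lam * R) ^ 2 ≤ R₀ ^ 2 := pow_le_pow_left₀ hlR hR1 2
      refine ⟨?_, by nlinarith [hs.2]⟩
      nlinarith [mul_lt_mul_of_pos_left hs.1 hl2]
    exact isAxisymmetric_rescale (h.axisymmetric _ ht) lam b lam
  · obtain ⟨C, hC⟩ := h.typeI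
    refine ⟨C, ?_⟩
    have h1 := ae_restrict_of_ae_restrict_of_subset hsub
      (ae_restrict_preimage_stAffine hl2 hlam 0 (b • eZ) hC)
    filter_upwards [h1] with z hz
    have hsq : Real.sqrt (-(0 + lam ^ 2 * z.1)) = lam * Real.sqrt (-z.1) := by
      rw [zero_add, show -(lam ^ 2 * z.1) = lam ^ 2 * -z.1 by ring, Real.sqrt_mul hl2.le,
        Real.sqrt_sq hlam.le]
    rw [smul_stPull_apply, norm_smul, Real.norm_eq_abs, abs_of_pos hlam]
    calc Real.sqrt (-z.1) * (lam * ‖v (0 + lam ^ 2 * z.1) (b • eZ + lam • z.2)‖)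
        = Real.sqrt (-(0 + lam ^ 2 * z.1)) * ‖v (0 + lam ^ 2 * z.1) (b • eZ + lam • z.2)‖ := by
          rw [hsq]; ring
      _ ≤ C := hz

variable {u : ℝ → (EuclideanSpace ℝ (Fin 3)) → (EuclideanSpace ℝ (Fin 3))} {p : ℝ → (EuclideanSpace ℝ (Fin 3)) → ℝ}

/-- The pair on `Q(0, 3)` seen at unit scale: `v(s, y) = 3 u(9 s, 3 y)`, `q = 9 p ∘ Φ` satisfy the
conditions of Thm. 3.1 on `Q = Q(0, 1)` (`Φ(s, y) = (9 s, 3 y)` maps `Q` onto `Q(0, 3)`).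
[cite: SereginSverak2009, §3 (scaling, arXiv p. 9)] -/
theorem IsTypeIAxisymmetricSolutionOn.toUnitScale (h : IsTypeIAxisymmetricSolutionOn 3 u p) :
    IsTypeIAxisymmetricSolutionOn 1 ((3 : ℝ) • stPull ((3 : ℝ) ^ 2) 3 0 ((0 : ℝ) • eZ) u)
      ((3 : ℝ) ^ 2 • stPull ((3 : ℝ) ^ 2) 3 0 ((0 : ℝ) • eZ) p) :=
  h.rescaleFrom (by norm_num) one_pos (by norm_num) 0 (by norm_num)

/-- `Φ(s, y) = (s/9, y/3)` pulls `Q = Q(0, 1)` back to `Q(0, 3)`. [folklore] -/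
theorem stPreimage_ninth_third_parCylOpens :
    stPreimage (1 / 9) (1 / 3) 0 (0 : (EuclideanSpace ℝ (Fin 3))) (parCylOpens 0 1) = parCylOpens (0 : ℝ × (EuclideanSpace ℝ (Fin 3))) 3 := by
  ext z
  change z ∈ stAffine (1 / 9) (1 / 3) 0 (0 : (EuclideanSpace ℝ (Fin 3))) ⁻¹' parCyl ((0 : ℝ), (0 : (EuclideanSpace ℝ (Fin 3)))) 1 ↔ z ∈ parCyl 0 3
  rw [show (1 / 9 : ℝ) = (1 / 3) ^ 2 by norm_num, stAffine_preimage_parCyl (by norm_num) 0 0 1]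
  norm_num

/-- **Seregin–Šverák 2009, Remark 3.4, transported to `Q(0, 3)`**: under `SuitableOfBounded`
(Remark 3.4: under the standing assumptions, axial symmetry and (r2), the pair is a suitable weak
solution in `Q`), every pair in the class `IsTypeIAxisymmetricSolutionOn 3` is a suitable weak
solution in `Q(0, 3)` — apply Remark 3.4 to `v(s,y) = 3u(9s, 3y)`, `q = 9p ∘ Φ` on `Q`
((r3) ⇒ (r2), `isBoundedAwayFromZero_of_isTypeIOnCyl`) and scale back with the accepted
covariance `IsSuitableWeakSolutionOn.stRescale` (`α = γ = 1/3`, `β = 1/9`).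
[cite: SereginSverak2009, Remark 3.4 and §3 (scaling, arXiv p. 9)] -/
theorem IsTypeIAxisymmetricSolutionOn.isSuitable (h34 : SuitableOfBounded)
    (h : IsTypeIAxisymmetricSolutionOn 3 u p) :
    IsSuitableWeakSolutionOn (parCylOpens 0 3) 1 0 u p := by
  set v : ℝ → (EuclideanSpace ℝ (Fin 3)) → (EuclideanSpace ℝ (Fin 3)) := (3 : ℝ) • stPull ((3 : ℝ) ^ 2) 3 0 ((0 : ℝ) • eZ) u with hv
  set q : ℝ → (EuclideanSpace ℝ (Fin 3)) → ℝ := (3 : ℝ) ^ 2 • stPull ((3 : ℝ) ^ 2) 3 0 ((0 : ℝ) • eZ) p with hq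
  obtain ⟨hsol, hI⟩ := isTypeIAxisymmetricSolutionOn_one_iff.1 h.toUnitScale
  have hsws : IsSuitableWeakSolutionOn (parCylOpens 0 1) 1 0 v q :=
    h34 v q hsol (isBoundedAwayFromZero_of_isTypeIOnCyl hI)
  have key := hsws.stRescale (α := 1 / 3) (β := 1 / 9) (γ := 1 / 3) (by norm_num) (by norm_num)
    (by norm_num) 0 0
  have hu : ((1 / 3 : ℝ) • stPull (1 / 9) (1 / 3) 0 (0 : (EuclideanSpace ℝ (Fin 3))) v) = u := by
    funext s y
    rw [smul_stPull_apply, hv, smul_stPull_apply]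
    have e1 : (3 : ℝ) ^ 2 * (1 / 9 * s) = s := by ring
    simp only [zero_smul, zero_add, smul_smul, e1]
    norm_num
  have hp : ((1 / 3 : ℝ) ^ 2 • stPull (1 / 9) (1 / 3) 0 (0 : (EuclideanSpace ℝ (Fin 3))) q) = p := by
    funext s y
    rw [smul_stPull_apply, hq, smul_stPull_apply]
    have e1 : (3 : ℝ) ^ 2 * (1 / 9 * s) = s := by ring
    simp only [zero_smul, zero_add, smul_smul, e1]
    norm_num
  have hf : (((1 / 3 : ℝ) ^ 2 * (1 / 3)) • stPull (1 / 9) (1 / 3) 0 (0 : (EuclideanSpace ℝ (Fin 3))) (0 : ℝ → (EuclideanSpace ℝ (Fin 3)) → (EuclideanSpace ℝ (Fin 3)))) =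
      0 := by
    funext s y
    simp [stPull]
  have hν : (1 / 3 : ℝ) * 1 / (1 / 3) = 1 := by norm_num
  rw [hu, hp, hf, hν, stPreimage_ninth_third_parCylOpens] at key
  exact key

/-! ### The data of `𝒜₂ ≤ K` -/

section Data

variable {G : ℝ → (EuclideanSpace ℝ (Fin 3)) → (EuclideanSpace ℝ (Fin 3)) →L[ℝ] (EuclideanSpace ℝ (Fin 3))} {K : ℝ≥0} {z₀ : ℝ × (EuclideanSpace ℝ (Fin 3))} {r : ℝ}

/-- The four bounds packed in `𝒜₂(u, p) ≤ K`: `∫_{𝒫²₁} |u(s)|² ≤ K` for a.e. `-4 < s < 0`,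
`∫_{Q̃} |∇u|² ≤ K`, `∫_{Q̃} |u|³ ≤ K`, `∫_{Q̃} |p|^{3/2} ≤ K`.
[cite: SereginZajaczkowski2007, Prop. 4.1 (definition of 𝒜₂, arXiv p. 5)] -/
theorem szEnergy_bounds (hK : szEnergy u p G ≤ K) :
    (∀ᵐ s ∂(volume.restrict (Ioo (-2 ^ 2 : ℝ) 0)),
        ∫⁻ y in outerShellSpace 1 0, ‖u s y‖ₑ ^ 2 ≤ K) ∧
      (∫⁻ z in outerShell 1 0, ENNReal.ofReal (frobeniusNormSq (G z.1 z.2))) ≤ K ∧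
      (∫⁻ z in outerShell 1 0, ‖u z.1 z.2‖ₑ ^ (3 : ℕ)) ≤ K ∧
      (∫⁻ z in outerShell 1 0, ‖p z.1 z.2‖ₑ ^ (3 / 2 : ℝ)) ≤ K := by
  unfold szEnergy at hK
  refine ⟨?_, le_add_self.trans (le_self_add.trans (le_self_add.trans hK)),
    le_add_self.trans (le_self_add.trans hK), le_add_self.trans hK⟩
  have h1 : essSup (fun s : ℝ => ∫⁻ y in outerShellSpace 1 0, ‖u s y‖ₑ ^ 2)
      (volume.restrict (Ioo (-2 ^ 2) 0)) ≤ K :=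
    le_self_add.trans (le_self_add.trans (le_self_add.trans hK))
  filter_upwards [ENNReal.ae_le_essSup fun s : ℝ => ∫⁻ y in outerShellSpace 1 0, ‖u s y‖ₑ ^ 2]
    with s hs using hs.trans h1

/-- `D(1/4; z₀) ≤ 16 K` when `∫_{Q̃} |p|^{3/2} ≤ K` (`Q_{1/4}(z₀) ⊆ Q(z₀, 1/4) ⊆ Q̃`). [folklore] -/
theorem cknD_quarter_le_of_bound (h₀ : z₀ ∈ shellCyl 1 2 1 1)
    (hD : (∫⁻ z in outerShell 1 0, ‖p z.1 z.2‖ₑ ^ (3 / 2 : ℝ)) ≤ K) :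
    cknD (1 / 4) z₀ p ≤ ((16 * K : ℝ≥0) : ℝ≥0∞) := by
  have e16 : (ENNReal.ofReal (1 / 4 : ℝ) ^ 2)⁻¹ = 16 := by
    rw [ofReal_pow_inv (by norm_num : (0 : ℝ) < 1 / 4) 2]
    norm_num
  unfold cknD
  rw [e16]
  push_cast
  exact mul_le_mul' le_rfl ((lintegral_mono_set ((parabolicCylinder_subset_parCyl _ _).trans
    (parCyl_subset_outerShell h₀ le_rfl))).trans hD)

/-- `∫_{Q_r(z₀)} |u|³ = r² C(r; z₀)` for `r > 0`. [folklore] -/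
theorem setLIntegral_eq_mul_cknC (z₀ : ℝ × (EuclideanSpace ℝ (Fin 3))) {r : ℝ} (hr : 0 < r) (u : ℝ → (EuclideanSpace ℝ (Fin 3)) → (EuclideanSpace ℝ (Fin 3))) :
    ∫⁻ z in parabolicCylinder r z₀, ‖u z.1 z.2‖ₑ ^ (3 : ℕ) = ENNReal.ofReal r ^ 2 * cknC r z₀ u := by
  rw [cknC, ← mul_assoc, ENNReal.mul_inv_cancel (by positivity) (by simp), one_mul]

/-- `∫_{Q_r(z₀)} |p|^{3/2} = r² D(r; z₀)` for `r > 0`. [folklore] -/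
theorem setLIntegral_eq_mul_cknD (z₀ : ℝ × (EuclideanSpace ℝ (Fin 3))) {r : ℝ} (hr : 0 < r) (p : ℝ → (EuclideanSpace ℝ (Fin 3)) → ℝ) :
    ∫⁻ z in parabolicCylinder r z₀, ‖p z.1 z.2‖ₑ ^ (3 / 2 : ℝ) =
      ENNReal.ofReal r ^ 2 * cknD r z₀ p := by
  rw [cknD, ← mul_assoc, ENNReal.mul_inv_cancel (by positivity) (by simp), one_mul]

end Data

/-! ### One step of the iteration -/

/-- The ratios of consecutive scales `r₁ = s²`, `r = (σ s)²`: `r/r₁ = σ²`, `(r₁/r)² = σ⁻⁴`. [folklore] -/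
theorem scale_ratios {σ s : ℝ} (hσ : 0 < σ) (hs : 0 < s) :
    (σ * s) ^ 2 / s ^ 2 = σ ^ 2 ∧ (s ^ 2 / (σ * s) ^ 2) ^ 2 = (σ ^ 4)⁻¹ := by
  constructor
  · field_simp
  · field_simp

/-- One step of the iteration in `ℝ≥0∞`: from `D' ≤ c (σ² D + e C)`, `c σ² ≤ 1/2`, `D ≤ g` and
`C ≤ a s` conclude `D' ≤ g/2 + c e a s`. [folklore] -/
theorem decay_step_ennreal {D D' C : ℝ≥0∞} {c σ e a g s : ℝ≥0} (hcσ : c * σ ^ 2 ≤ 1 / 2)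
    (hF : D' ≤ c * ((σ ^ 2 : ℝ≥0) * D + (e : ℝ≥0∞) * C)) (hD : D ≤ g) (hC : C ≤ a * s) :
    D' ≤ ((g / 2 + c * e * a * s : ℝ≥0) : ℝ≥0∞) := by
  have h1 : D' ≤ ((c * σ ^ 2 * g + c * e * a * s : ℝ≥0) : ℝ≥0∞) := by
    calc D' ≤ c * ((σ ^ 2 : ℝ≥0) * (g : ℝ≥0∞) + (e : ℝ≥0∞) * (a * s : ℝ≥0∞)) := by
          refine hF.trans ?_
          gcongr
      _ = ((c * σ ^ 2 * g + c * e * a * s : ℝ≥0) : ℝ≥0∞) := by push_cast; ring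
  refine h1.trans ?_
  have h2 : c * σ ^ 2 * g ≤ g / 2 := by
    calc c * σ ^ 2 * g ≤ 1 / 2 * g := mul_le_mul_of_nonneg_right hcσ (by positivity)
      _ = g / 2 := by ring
  exact_mod_cast add_le_add h2 le_rfl

/-- A ratio `σ ∈ ]0, 1[` with `c σ² ≤ 1/2` ("We can choose `τ ∈ ]0,1[` so small to provide
`c τ^{3/4} ≤ 1`", Seregin–Zajaczkowski 2007, arXiv p. 3; here `τ = σ²`). [folklore] -/
theorem exists_ratio_sq (c : ℝ≥0) : ∃ σ : ℝ≥0, 0 < σ ∧ σ < 1 ∧ c * σ ^ 2 ≤ 1 / 2 := by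
  have hc : (0 : ℝ) ≤ c := c.coe_nonneg
  refine ⟨(2 * c + 2)⁻¹, by positivity, ?_, ?_⟩
  · rw [← NNReal.coe_lt_coe]
    push_cast
    rw [inv_lt_one_iff₀]
    right
    linarith
  · rw [← NNReal.coe_le_coe]
    push_cast
    rw [inv_pow, ← div_eq_mul_inv, div_le_iff₀ (by positivity)]
    nlinarith [sq_nonneg (c : ℝ)]


/-! ### The scales `s_k` -/

/-- The scales `s_k = σ^k/2` are positive with `s_k² ≤ 1/4` (`σ ≤ 1`). [folklore] -/
theorem epsHalfScale_pos_sq_le {σ : ℝ≥0} (hσ0 : 0 < σ) (hσ1 : σ < 1) (k : ℕ) :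
    0 < ((epsHalfScale σ k : ℝ≥0) : ℝ) ∧ ((epsHalfScale σ k : ℝ≥0) : ℝ) ^ 2 ≤ 1 / 4 := by
  have hσR : (0 : ℝ) < σ := by exact_mod_cast hσ0
  have hσ1R : (σ : ℝ) ≤ 1 := by exact_mod_cast hσ1.le
  have e : ((epsHalfScale σ k : ℝ≥0) : ℝ) = (σ : ℝ) ^ k / 2 := by simp [epsHalfScale]
  rw [e]
  have h1 : (σ : ℝ) ^ k ≤ 1 := pow_le_one₀ hσR.le hσ1R
  have h2 : 0 < (σ : ℝ) ^ k := pow_pos hσR k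
  exact ⟨by positivity, by nlinarith⟩

/-- The scales decrease: `s_{k'} ≤ s_k` for `k ≤ k'` (`σ ≤ 1`). [folklore] -/
theorem epsHalfScale_antitone {σ : ℝ≥0} (hσ1 : σ ≤ 1) {k k' : ℕ} (h : k ≤ k') :
    epsHalfScale σ k' ≤ epsHalfScale σ k := by
  unfold epsHalfScale
  rw [div_eq_mul_inv, div_eq_mul_inv]
  exact mul_le_mul_of_nonneg_right (pow_le_pow_of_le_one (by positivity) hσ1 h) (by positivity)

end SereginSverak2009

end Literature.Analysis.FluidPDE
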